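import Literature.Algebra.Lie.SurfaceLieAlgebra
import Literature.Algebra.Lie.FreeLieAlgebraGrading
import HarnessLib

/-!
# Elimination of `b₁` in the surface Lie algebra: a homogeneous spanning set

Topic `Literature/Algebra/Lie`. Let `𝔰 = 𝔰_{g+1}(R) = L(a₀, b₀, …, a_g, b_g)/(∑ᵢ ⁅aᵢ, bᵢ⁆)` be the
surface Lie algebra (`Literature.Algebra.Lie.SurfaceLieAlgebra`, genus `g + 1`, distinguished pair
`a₀, b₀`). Following the elimination method of Labute (*Algèbres de Lie et pro-p-groupes définis
par une seule relation*, Invent. Math. 4 (1967), §2–3; it is the Lie analogue of Magnus'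
Freiheitssatz rewriting, and the mechanism behind Prop. 4 of Labute, J. Algebra 14 (1970)) one
"eliminates" the generator `b₀`: the elements

  `a₀`, and `ad(b₀)^k (aⱼ)`, `ad(b₀)^k (bⱼ)` (`j ≥ 1`, `k ≥ 0`), of weights `1` and `k + 1`,

(`Literature.Algebra.Lie.SurfaceElim.egen`, indexed by `EGen g = Option (Fin g × Bool × ℕ)`)
generate, together with `b₀`, the Lie algebra `𝔰`, and more precisely (this file's main result,
`SurfaceElim.grade_le_elimSpan`):

  **for `n ≥ 2` the degree-`n` piece `𝔰_n` is contained in the `R`-span of the iterated brackets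
  of these elements of total weight `n`** (`SurfaceElim.elimSpan R g n`);

in degree `1`, `𝔰₁ ⊆ elimSpan 1 + R b₀` (`grade_one_le`). The key computation is that `ad(b₀)`
preserves these spans and raises the weight by one (`adb_mem_elimSpan_succ`): on the new
generators it shifts `k`, and `ad(b₀)(a₀) = ⁅b₀, a₀⁆ = ∑_{j ≥ 1} ⁅aⱼ, bⱼ⁆` by the defining relation
(`adb_a_zero`). (Labute proves the sharper statement that `𝔰` is the semidirect product of `R b₀`
with the FREE Lie algebra on these generators; only the spanning half is needed for
`Labute1970_grSurfaceGroup` and only it is proved here.) Also: the weighted word spans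
`wspan R f wt n` of any family in any Lie algebra (`lie_mem_wspan`), and the description of
`elimSpan` as the image of the corresponding span of the free Lie algebra on `EGen g`
(`elimSpan_eq_map`, `exists_lift_eq_of_mem_elimSpan`).

Everything is proved; there are no named facts.

## References

* J. P. Labute, Algèbres de Lie et pro-p-groupes définis par une seule relation, Invent. Math. 4
  (1967) 142–158, §2–3 (elimination).
* J. P. Labute, J. Algebra 14 (1970) 16–23, Prop. 4. [Labute1970]
* N. Bourbaki, *Lie groups and Lie algebras*, Ch. II §2.9 (elimination theorem).
-/

noncomputable section

namespace Literature.Algebra.Lie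

/-! ## Weighted word spans in a Lie algebra -/

section WSpan

variable (R : Type*) [CommRing R] {Y : Type*} {L : Type*} [LieRing L] [LieAlgebra R L]

/-- The `R`-span of the iterated brackets `⟦w⟧_f` of the bracket shapes `w` of total weight `n`
(weight of a leaf `y` is `wt y`). [folklore] -/
def wspan (f : Y → L) (wt : Y → ℕ) (n : ℕ) : Submodule R L :=
  Submodule.span R (bracketWord f '' {w | magmaWeight wt w = n})

variable {R}

/-- A bracket shape of weight `n` lies in the weight-`n` span. [folklore] -/
theorem bracketWord_mem_wspan (f : Y → L) (wt : Y → ℕ) (w : FreeMagma Y) :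
    bracketWord f w ∈ wspan R f wt (magmaWeight wt w) :=
  Submodule.subset_span ⟨w, rfl, rfl⟩

/-- A letter lies in the span of its weight. [folklore] -/
theorem mem_wspan_self (f : Y → L) (wt : Y → ℕ) (y : Y) : f y ∈ wspan R f wt (wt y) :=
  bracketWord_mem_wspan f wt (FreeMagma.of y)

/-- The weighted spans are bracket-closed: `⁅P_m, P_n⁆ ⊆ P_{m+n}`. [folklore] -/
theorem lie_mem_wspan {f : Y → L} {wt : Y → ℕ} {m n : ℕ} {x y : L} (hx : x ∈ wspan R f wt m)
    (hy : y ∈ wspan R f wt n) : ⁅x, y⁆ ∈ wspan R f wt (m + n) := by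
  refine Submodule.span_induction
    (p := fun x _ => ∀ y ∈ wspan R f wt n, ⁅x, y⁆ ∈ wspan R f wt (m + n)) ?_ ?_ ?_ ?_ hx y hy
  · rintro _ ⟨u, hu, rfl⟩ y hy
    refine Submodule.span_induction (p := fun y _ => ⁅bracketWord f u, y⁆ ∈ wspan R f wt (m + n))
      ?_ ?_ ?_ ?_ hy
    · rintro _ ⟨v, hv, rfl⟩
      refine Submodule.subset_span ⟨u * v, ?_, rfl⟩
      change magmaWeight wt u = m at hu
      change magmaWeight wt v = n at hv
      change magmaWeight wt u + magmaWeight wt v = m + n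
      rw [hu, hv]
    · simp
    · intro y z _ _ hy hz; rw [lie_add]; exact add_mem hy hz
    · intro c y _ hy; rw [lie_smul]; exact Submodule.smul_mem _ c hy
  · intro y _; simp
  · intro x x' _ _ hx hx' y hy; rw [add_lie]; exact add_mem (hx y hy) (hx' y hy)
  · intro c x _ hx y hy; rw [smul_lie]; exact Submodule.smul_mem _ c (hx y hy)

/-- A derivation-like map which sends each letter of weight `k` into `P_{k+1}` sends `P_n` into
`P_{n+1}` (applied to `ad(b₀)`). [folklore] -/
theorem map_mem_wspan_succ {f : Y → L} {wt : Y → ℕ} (D : L →ₗ[R] L)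
    (hD : ∀ x y : L, D ⁅x, y⁆ = ⁅D x, y⁆ + ⁅x, D y⁆) (hgen : ∀ y, D (f y) ∈ wspan R f wt (wt y + 1))
    {n : ℕ} {x : L} (hx : x ∈ wspan R f wt n) : D x ∈ wspan R f wt (n + 1) := by
  refine Submodule.span_induction (p := fun x _ => D x ∈ wspan R f wt (n + 1)) ?_ ?_ ?_ ?_ hx
  · rintro _ ⟨w, hw, rfl⟩
    change magmaWeight wt w = n at hw
    subst hw
    clear hx x
    induction w using FreeMagma.recOnMul with
    | ih1 y => exact hgen y
    | ih2 u v hu hv =>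
      rw [bracketWord_mul, hD, magmaWeight_mul]
      refine add_mem ?_ ?_
      · have := lie_mem_wspan hu (bracketWord_mem_wspan (R := R) f wt v)
        rwa [show magmaWeight wt u + 1 + magmaWeight wt v = magmaWeight wt u + magmaWeight wt v + 1
          by ring] at this
      · have := lie_mem_wspan (bracketWord_mem_wspan (R := R) f wt u) hv
        rwa [← add_assoc] at this
  · rw [map_zero]; exact Submodule.zero_mem _
  · intro x y _ _ hx hy; rw [map_add]; exact add_mem hx hy
  · intro c x _ hx; rw [map_smul]; exact Submodule.smul_mem _ c hx

/-- The weighted span is the image of the corresponding span in the free Lie algebra on `Y`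
under the universal morphism. [folklore] -/
theorem wspan_eq_map (f : Y → L) (wt : Y → ℕ) (n : ℕ) :
    wspan R f wt n = (wspan R (FreeLieAlgebra.of R) wt n).map
      (FreeLieAlgebra.lift R f : FreeLieAlgebra R Y →ₗ[R] L) := by
  unfold wspan
  rw [Submodule.map_span, ← Set.image_comp]
  congr 1
  ext w
  simp only [Set.mem_image, Function.comp_apply, LieHom.coe_toLinearMap, map_bracketWord,
    FreeLieAlgebra.of_comp_lift]

end WSpan

/-! ## The elimination generators of `𝔰_{g+1}` -/

namespace SurfaceElim

open SurfaceLieAlgebra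

variable (R : Type*) [CommRing R] (g : ℕ)

/-- The index set of the **elimination generators** of `𝔰_{g+1}`: `none ↔ a₀`, and
`some (j, ε, k) ↔ ad(b₀)^k (x_{j+1,ε})` with `x_{j+1,false} = a_{j+1}`, `x_{j+1,true} = b_{j+1}`.
[cite: Labute1970, Prop. 4 (via Labute 1967 §2–3, elimination)] -/
abbrev EGen : Type := Option (Fin g × Bool × ℕ)

/-- The weight of an elimination generator: `wt a₀ = 1`, `wt (ad(b₀)^k x) = k + 1`. [folklore] -/
def wtE : EGen g → ℕ
  | none => 1
  | some (_, _, k) => k + 1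

/-- `ad(b₀)` on `𝔰_{g+1}`. [folklore] -/
def adb : SurfaceLieAlgebra R (g + 1) →ₗ[R] SurfaceLieAlgebra R (g + 1) :=
  (LieAlgebra.ad R (SurfaceLieAlgebra R (g + 1)) (b R (g + 1) 0) : _ →ₗ[R] _)

/-- `adb x = ⁅b₀, x⁆`. [folklore] -/
@[simp] theorem adb_apply (x : SurfaceLieAlgebra R (g + 1)) : adb R g x = ⁅b R (g + 1) 0, x⁆ := rfl

/-- `ad(b₀)` is a derivation. [folklore] -/
theorem adb_lie (x y : SurfaceLieAlgebra R (g + 1)) : adb R g ⁅x, y⁆ = ⁅adb R g x, y⁆ + ⁅x, adb R g y⁆ := by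
  simp only [adb_apply]
  exact leibniz_lie _ x y

/-- The **elimination generators** `a₀`, `ad(b₀)^k a_{j+1}`, `ad(b₀)^k b_{j+1}` of `𝔰_{g+1}`.
[cite: Labute1970, Prop. 4 (via Labute 1967 §2–3, elimination)] -/
def egen : EGen g → SurfaceLieAlgebra R (g + 1)
  | none => a R (g + 1) 0
  | some (j, ε, k) => (adb R g)^[k] (gen R (g + 1) (j.succ, ε))

/-- `egen none = a₀`. [folklore] -/
@[simp] theorem egen_none : egen R g none = a R (g + 1) 0 := rfl

/-- `egen (j, ε, 0) = x_{j+1, ε}`. [folklore] -/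
@[simp] theorem egen_zero (j : Fin g) (ε : Bool) : egen R g (some (j, ε, 0)) = gen R (g + 1) (j.succ, ε) := rfl

/-- `ad(b₀)` shifts the generators: `adb (egen (j, ε, k)) = egen (j, ε, k+1)`. [folklore] -/
theorem adb_egen_some (j : Fin g) (ε : Bool) (k : ℕ) :
    adb R g (egen R g (some (j, ε, k))) = egen R g (some (j, ε, k + 1)) := by
  change adb R g ((adb R g)^[k] _) = (adb R g)^[k + 1] _
  rw [Function.iterate_succ_apply']

/-- **The relation, solved for `⁅b₀, a₀⁆`**: `ad(b₀)(a₀) = ∑_{j ≥ 1} ⁅aⱼ, bⱼ⁆`. [folklore] -/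
theorem adb_a_zero : adb R g (a R (g + 1) 0) = ∑ j : Fin g, ⁅a R (g + 1) j.succ, b R (g + 1) j.succ⁆ := by
  have h := sum_lie_a_b R (g + 1)
  rw [Fin.sum_univ_succ] at h
  rw [adb_apply, ← lie_skew, neg_eq_iff_eq_neg]
  exact eq_neg_of_add_eq_zero_left h

/-- The **weight-`n` elimination span** `P_n ⊆ 𝔰_{g+1}`: the `R`-span of the iterated brackets of
elimination generators of total weight `n`. [folklore] -/
def elimSpan (n : ℕ) : Submodule R (SurfaceLieAlgebra R (g + 1)) := wspan R (egen R g) (wtE g) n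

/-- `ad(b₀)` maps each elimination generator of weight `k` into `P_{k+1}`. [folklore] -/
theorem adb_egen_mem (y : EGen g) : adb R g (egen R g y) ∈ elimSpan R g (wtE g y + 1) := by
  rcases y with _ | ⟨j, ε, k⟩
  · -- `a₀ ↦ ∑ ⁅a_{j+1}, b_{j+1}⁆`, a sum of brackets of two weight-one generators
    rw [egen_none, adb_a_zero]
    refine Submodule.sum_mem _ fun j _ => ?_
    have ha := mem_wspan_self (R := R) (egen R g) (wtE g) (some (j, false, 0))
    have hb := mem_wspan_self (R := R) (egen R g) (wtE g) (some (j, true, 0))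
    exact lie_mem_wspan ha hb
  · rw [adb_egen_some]
    exact mem_wspan_self (R := R) (egen R g) (wtE g) (some (j, ε, k + 1))

/-- **`ad(b₀)` raises the weight by one**: `ad(b₀)(P_n) ⊆ P_{n+1}`. [folklore] -/
theorem adb_mem_elimSpan_succ {n : ℕ} {x : SurfaceLieAlgebra R (g + 1)} (hx : x ∈ elimSpan R g n) :
    adb R g x ∈ elimSpan R g (n + 1) :=
  map_mem_wspan_succ (adb R g) (adb_lie R g) (adb_egen_mem R g) hx

/-- Every generator `x ≠ b₀` of `𝔰_{g+1}` is an elimination generator of weight `1`. [folklore] -/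
theorem gen_mem_elimSpan_one {x : Fin (g + 1) × Bool} (hx : x ≠ (0, true)) :
    gen R (g + 1) x ∈ elimSpan R g 1 := by
  obtain ⟨i, ε⟩ := x
  refine Fin.cases ?_ (fun j => ?_) i hx
  · intro h
    cases ε
    · exact mem_wspan_self (R := R) (egen R g) (wtE g) none
    · exact absurd rfl h
  · intro _
    exact mem_wspan_self (R := R) (egen R g) (wtE g) (some (j, ε, 0))

/-- Bracketing with a generator raises the weight: `⁅gen x, P_n⁆ ⊆ P_{n+1}`. [folklore] -/
theorem gen_lie_mem_elimSpan_succ (x : Fin (g + 1) × Bool) {n : ℕ} {u : SurfaceLieAlgebra R (g + 1)}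
    (hu : u ∈ elimSpan R g n) : ⁅gen R (g + 1) x, u⁆ ∈ elimSpan R g (n + 1) := by
  by_cases hx : x = (0, true)
  · subst hx
    exact adb_mem_elimSpan_succ R g hu
  · have := lie_mem_wspan (gen_mem_elimSpan_one R g hx) hu
    rwa [Nat.add_comm 1 n] at this

/-- Brackets of two generators lie in `P_2`. [folklore] -/
theorem gen_lie_gen_mem (x y : Fin (g + 1) × Bool) : ⁅gen R (g + 1) x, gen R (g + 1) y⁆ ∈ elimSpan R g 2 := by
  by_cases hy : y = (0, true)
  · subst hy
    by_cases hx : x = (0, true)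
    · subst hx; rw [lie_self]; exact Submodule.zero_mem _
    · rw [← lie_skew]
      exact Submodule.neg_mem _ (adb_mem_elimSpan_succ R g (gen_mem_elimSpan_one R g hx))
  · exact gen_lie_mem_elimSpan_succ R g x (gen_mem_elimSpan_one R g hy)

/-- `⁅gen x, 𝔰₁⁆ ⊆ P_2`. [folklore] -/
theorem gen_lie_mem_of_mem_grade_one (x : Fin (g + 1) × Bool) {u : SurfaceLieAlgebra R (g + 1)}
    (hu : u ∈ grade R (g + 1) 1) : ⁅gen R (g + 1) x, u⁆ ∈ elimSpan R g 2 := by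
  change u ∈ wordGrade R (gen R (g + 1)) 1 at hu
  rw [wordGrade_one] at hu
  refine Submodule.span_induction (p := fun u _ => ⁅gen R (g + 1) x, u⁆ ∈ elimSpan R g 2) ?_ ?_ ?_ ?_ hu
  · rintro _ ⟨y, rfl⟩; exact gen_lie_gen_mem R g x y
  · rw [lie_zero]; exact Submodule.zero_mem _
  · intro u v _ _ hu hv; rw [lie_add]; exact add_mem hu hv
  · intro c u _ hu; rw [lie_smul]; exact Submodule.smul_mem _ c hu

/-- **Elimination spanning** (Labute): for `n ≥ 2` the degree-`n` piece of `𝔰_{g+1}` is spanned by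
the weight-`n` iterated brackets of `a₀`, `ad(b₀)^k a_{j+1}`, `ad(b₀)^k b_{j+1}`.
[cite: Labute1970, Prop. 4 (free graded module structure of L/(ρ), via Labute 1967 §2–3)] -/
theorem grade_le_elimSpan {n : ℕ} (hn : 2 ≤ n) : grade R (g + 1) n ≤ elimSpan R g n := by
  obtain ⟨m, rfl⟩ : ∃ m, n = m + 2 := ⟨n - 2, by omega⟩
  clear hn
  induction m with
  | zero =>
    intro u hu
    change u ∈ wordGrade R (gen R (g + 1)) (0 + 2) at hu
    refine Submodule.span_induction (p := fun u _ => u ∈ elimSpan R g (0 + 2)) ?_ ?_ ?_ ?_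
      (wordGrade_succ_succ_le_span_lie (gen R (g + 1)) 0 hu)
    · rintro _ ⟨x, v, hv, rfl⟩; exact gen_lie_mem_of_mem_grade_one R g x hv
    · exact Submodule.zero_mem _
    · intro u v _ _ hu hv; exact add_mem hu hv
    · intro c u _ hu; exact Submodule.smul_mem _ c hu
  | succ m ih =>
    intro u hu
    change u ∈ wordGrade R (gen R (g + 1)) (m + 1 + 2) at hu
    refine Submodule.span_induction (p := fun u _ => u ∈ elimSpan R g (m + 1 + 2)) ?_ ?_ ?_ ?_
      (wordGrade_succ_succ_le_span_lie (gen R (g + 1)) (m + 1) hu)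
    · rintro _ ⟨x, v, hv, rfl⟩
      exact gen_lie_mem_elimSpan_succ R g x (ih hv)
    · exact Submodule.zero_mem _
    · intro u v _ _ hu hv; exact add_mem hu hv
    · intro c u _ hu; exact Submodule.smul_mem _ c hu

/-- In degree one: `𝔰₁ ⊆ P_1 + R b₀`. [folklore] -/
theorem grade_one_le : grade R (g + 1) 1 ≤ elimSpan R g 1 ⊔ R ∙ b R (g + 1) 0 := by
  change wordGrade R (gen R (g + 1)) 1 ≤ _
  rw [wordGrade_one, Submodule.span_le]
  rintro _ ⟨x, rfl⟩
  by_cases hx : x = (0, true)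
  · subst hx
    exact Submodule.mem_sup_right (Submodule.mem_span_singleton_self _)
  · exact Submodule.mem_sup_left (gen_mem_elimSpan_one R g hx)

/-- `P_n` is the image of the weight-`n` span of the free Lie algebra on `EGen g` under the
universal morphism `L(EGen g) → 𝔰_{g+1}` extending `egen`. [folklore] -/
theorem elimSpan_eq_map (n : ℕ) :
    elimSpan R g n = (wspan R (FreeLieAlgebra.of R) (wtE g) n).map
      (FreeLieAlgebra.lift R (egen R g) : FreeLieAlgebra R (EGen g) →ₗ[R] SurfaceLieAlgebra R (g + 1)) :=
  wspan_eq_map (egen R g) (wtE g) n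

/-- Elements of `P_n` lift to weight-`n` elements of the free Lie algebra on the elimination
generators. [folklore] -/
theorem exists_lift_eq_of_mem_elimSpan {n : ℕ} {u : SurfaceLieAlgebra R (g + 1)} (hu : u ∈ elimSpan R g n) :
    ∃ v ∈ wspan R (FreeLieAlgebra.of R) (wtE g) n, FreeLieAlgebra.lift R (egen R g) v = u := by
  rw [elimSpan_eq_map] at hu
  obtain ⟨v, hv, rfl⟩ := hu
  exact ⟨v, hv, rfl⟩

end SurfaceElim

end Literature.Algebra.Lie
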